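import Summits.BirchSwinnertonDyer.Rank1Residual.Supersingular.RankZeroKimTamDefectRecords
import Summits.BirchSwinnertonDyer.Rank1Residual.Supersingular.KuriharaTwistCertsK9PairN6B
import Summits.BirchSwinnertonDyer.Rank1Residual.Supersingular.KuriharaTwistRecordLevelKPairLevel
import HarnessLib

/-!
# N6 TAM-DEFECT (X8, `r_an = 0`, `ord₃ ∏c_ℓ = 1`) — STANDARD-CURRENCY twins of my two-prime-level records for 12155c1, 17200bj1, 18515u1:
# `bsdp_x8r0kim9L_<label>` = `bsdp_x8r0kim9_<label>` (`RankZeroKimTamDefectRecords.lean`, p308350) with the datum `hδ` replaced by the landed two-prime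
# depth-2 record + rounding certificate (`KuriharaTwistCertsK9PairN6B.lean`) + the engine's ENCLOSURE `hballL`

Cell `b2b-bsdres`, supersingular family, prover B = unit `b2b-bsdres-additive-p3` (gen 25; class lead N6·O3); companion of `RankZeroKimTamDefectRecord9950f1LValue.lean`.
Topic file; namespace `Summit.BirchSwinnertonDyer.Rank1Residual.Supersingular`.  THEOREMS ONLY: each is one `exact` onto my landed record with `hδ :=` this gen's
pair-level bridge `kuriharaNumber_pairLevel_ne_zero_of_ainvs_of_certifiedK_of_LValueBall` (p324167); good reduction at 3, both primes in `𝒫₂` (`countPointsFast`) and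
irreducibility (gen-21 surj certificates) re-derived in the kernel.  No definition, no named fact, nothing booked; X8 stays CONSTRUCTION-SHAPED; the records stay
CONDITIONAL on Kim 2025 (OPEN) and keep their other displayed binders (Wuthrich Prop. 21 `hW`, GZK, modularity, period transfer at 3, `r_an = 0`, `htam`).

HONEST FRAMING (run/shared/lean/b2b/bsd-rank1-residual/, verbatim in every file): the goal of the
cell is to DELETE the COMBINATION-SHAPED residual classes of the Birch–Swinnerton-Dyer formula for
ALL analytic-rank `≤ 1` elliptic curves over `ℚ` — "full BSD formula for every rank `≤ 1` curve in
class `C`" assembled STRICTLY from published theorems — so that the rank-`≤ 1` remainder becomes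
exactly the CONSTRUCTION-SHAPED classes, which are TYPED (missing-input `Prop`s), NOT attempted.
This is not "finishing BSD".  EVERY theorem here is CONDITIONAL on the ANNOUNCED preprint C.-H. Kim
(app. R. Pollack), arXiv:2505.09121 Thm. 1.1 (`hK25s`, OPEN binder) — a typed OPEN hypothesis, never a theorem.

References: [Kim2025RefinedTNC] Thm. 1.1 (ANNOUNCED, OPEN); [Kim2022StructureSelmer] §1.2.2, §1.4.3, Thm. 1.9 (6); [MazurTateTeitelbaum1986Invent] §I.8;
[CremonaAlgorithms1997] §2.8; [Cremona2006] Table 1.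
-/

set_option autoImplicit false

noncomputable section

open scoped Classical MatrixGroups ModularForm

open CongruenceSubgroup WeierstrassCurve Literature.NumberTheory.EllipticCurves
  Literature.NumberTheory.EllipticCurves.ModularForms
  Literature.NumberTheory.EllipticCurves.Rank1Residual
  Literature.NumberTheory.EllipticCurves.Rank1Residual.Typed
  Literature.NumberTheory.EllipticCurves.Rank1Residual.X11RankOneCertificates
  Literature.NumberTheory.EllipticCurves.Wuthrich2014
  Summit.BirchSwinnertonDyer.BirchSwinnertonDyer.Rank1Residual.IntModel
  Summit.BirchSwinnertonDyer.BirchSwinnertonDyer.Rank1Residual.X11RankOne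
  Summit.BirchSwinnertonDyer.Rank1Residual.X11b
  Summit.BirchSwinnertonDyer.Rank1Residual.Additive
  Summit.BirchSwinnertonDyer.Rank1Residual.Supersingular.KuriharaTwist

namespace Summit.BirchSwinnertonDyer.Rank1Residual.Supersingular

/-- **`BSD(E,3)` for `12155c1` at the two-prime level `433·757`, STANDARD CURRENCY** (N6 TAM-DEFECT cell: X8, `r_an = 0`, `N = 12155`, `ord₃ ∏c_ℓ = 1`): exactly my record
`bsdp_x8r0kim9_12155c1` (`RankZeroKimTamDefectRecords.lean`, p308350; `hδ` engines KURX k=2 v₃ = 1 / engine K R0k2 `δ̃ ≡ 3` / engine M JM4a j144389 MATCH) with its DATUM binder `hδ : kuriharaNumber D.f 9 327781 ψ ≠ 0` DISCHARGED IN THE KERNEL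
from the landed two-prime depth-2 record `certK9_X8r0_12155c1` + the rounding row `certRK9_X8r0_12155c1` (`KuriharaTwistCertsK9PairN6B.lean`, this gen; implementation 3d `δ̃ ≡ 3 (mod 9)`)
+ the engine's ENCLOSURE `hballL` of `D'·c_∞·re(-1944·L(E,1) + Σ_{j≠0} e_9(−jk)·τ(χ_j)·L_j(1))/(9·Ω⁺_f)` for the 9 bins (`A = (a_{433} − 2)(a_{757} − 2) = -1944`, `D' = 2`, `c_∞ = 1`,
margin ≤ 818·10^-23, radius ≤ 865·10^-14; `m₀ = 305401851`) via prover B's `kuriharaNumber_pairLevel_ne_zero_of_ainvs_of_certifiedK_of_LValueBall` (p324167); good reduction at 3,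
`433, 757 ∈ 𝒫₂` (`#Ẽ = 396, 810`, `countPointsFast`) and irreducibility (`surj_x8r0_12155c1_3`) re-derived in the kernel. BINDERS LEFT: the record's minus `hδ` plus `hballL`
(`hK25s` Kim 2025 OPEN; `hW` Wuthrich Prop. 21, `hGZK`, `hmod`, `h3per` published; `r_an = 0`, `htam`, `D`, `ψ`). Per pair; nothing booked; X8 CONSTRUCTION-SHAPED.
[claim: Kim2025RefinedTNC, status: under-review] [cite: Kim2025RefinedTNC, Thm. 1.1 (ANNOUNCED, OPEN binder)] [cite: Kim2022StructureSelmer, §1.2.2, §1.4.3 (PDF p. 7) and Thm. 1.9 (6)]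
[cite: MazurTateTeitelbaum1986Invent, §I.8 (8.6)] [cite: Cremona2006, Table 1 (Cremona label 12155c1)] -/
theorem bsdp_x8r0kim9L_12155c1
    (hK25s : Kim2025.thm11_kimShaLength_of_integralPeriod_OPEN) (hW : sha_dvd_analyticSha)
    (hGZK : rank_eq_analyticRank_of_analyticRank_le_one) (hmod : hasEntireLFunction_rat)
    (h3per : realPeriodRat_eq_unit_mul_plusPeriod_three)
    (W : WeierstrassCurve ℚ) (hWeq : W = ⟨1, -1, 0, -11230, -455389⟩) (hr : W.analyticRank = 0)
    (htam : 2 ≤ padicValNat 3 W.tamagawaProduct + 1)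
    {N : ℕ} [NeZero N] (D : ModularParametrizationData W N)
    (ψ : (ℓ : ℕ) → (ZMod ℓ)ˣ →* Multiplicative (ZMod (3 ^ 2)))
    (hψ : ∀ ℓ ∈ (327781 : ℕ).primeFactors, Function.Surjective (ψ ℓ))
    (hballL : ∀ (L : ZMod (3 ^ 2) → ℂ → ℂ), (∀ j, j ≠ 0 → Differentiable ℂ (L j)) →
      (∀ j, j ≠ 0 → ∀ s : ℂ, 2 < s.re → L j s = twistedLSeries D.f (binChar 327781 ψ j)⁻¹ s) →
      ∀ k < 3 ^ 2, ∃ mid rad : ℝ, rad ≤ ((865 : ℕ) : ℝ) / 10 ^ (14 : ℕ) ∧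
        |mid - (([1524, -28530, 3360, -14964, -14964, 3360, -28530, 1524, -27756].getD k 0 : ℤ) : ℝ)| ≤ ((818 : ℕ) : ℝ) / 10 ^ (23 : ℕ) ∧
        |((2 : ℕ) : ℝ) * (((1 : ℕ) : ℝ) *
          ((((-1944 : ℤ) : ℂ) * W.entireLFunction 1 +
            ∑ j ∈ (Finset.univ : Finset (ZMod (3 ^ 2))).erase 0,
              ZMod.stdAddChar (-(j * (k : ZMod (3 ^ 2)))) *
                (gaussSum (binChar 327781 ψ j) (ZMod.stdAddChar (N := 327781)) * L j 1)).re /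
            (((3 ^ 2 : ℕ) : ℝ) * plusPeriod D.f))) - mid| ≤ rad) : BSDp W 3 := by
  subst hWeq
  haveI : Fact (Nat.Prime 3) := ⟨by norm_num⟩
  haveI : Fact (Nat.Prime 433) := ⟨by norm_num⟩
  haveI : Fact (Nat.Prime 757) := ⟨by norm_num⟩
  haveI : NeZero (327781 : ℕ) := ⟨by decide⟩
  exact bsdp_x8r0kim9_12155c1 (hK25s := hK25s) (hW := hW) (hGZK := hGZK) (hmod := hmod) (h3per := h3per)
    (W := ⟨1, -1, 0, -11230, -455389⟩) (hWeq := rfl) (hr := hr) (htam := htam) (D := D) (ψ := ψ) (hψ := hψ)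
    (hδ := kuriharaNumber_pairLevel_ne_zero_of_ainvs_of_certifiedK_of_LValueBall 1 (-1) 0 (-11230) (-455389)
      (isGloballyMinimal_of_krausCriterion_bounded 1 (-1) 0 (-11230) (-455389)
        (by decide +kernel) (by decide +kernel) (by decide +kernel))
      certK9_X8r0_12155c1 (List.Mem.head _) (by decide) (by decide)
      certRK9_X8r0_12155c1 (List.Mem.head _) rfl rfl rfl rfl (by decide)
      (by decide) (np := 1) (countPoints_eq_of_fast (by decide +kernel)) (by decide)
      surj_x8r0_12155c1_3
      433 757 (by norm_num) (by norm_num)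
      (by norm_num) (by norm_num) (by decide) (by decide) (n₁ := 396) (countPoints_eq_of_fast (by decide +kernel)) (by decide)
      (by norm_num) (by norm_num) (by decide) (by decide) (n₂ := 810) (countPoints_eq_of_fast (by decide +kernel)) (by decide)
      (A := -1944) (by decide) D ψ
      (hψ 433 (Nat.mem_primeFactors.mpr ⟨by norm_num, by norm_num, by norm_num⟩))
      (hψ 757 (Nat.mem_primeFactors.mpr ⟨by norm_num, by norm_num, by norm_num⟩)) hballL)

/-- **`BSD(E,3)` for `17200bj1` at the two-prime level `109·523`, STANDARD CURRENCY** (N6 TAM-DEFECT cell: X8, `r_an = 0`, `N = 17200`, `ord₃ ∏c_ℓ = 1`): exactly my record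
`bsdp_x8r0kim9_17200bj1` (`RankZeroKimTamDefectRecords.lean`, p308350; `hδ` engines KURX v₃ = 1 / engine K `δ̃ ≡ 3` / engine M MATCH) with its DATUM binder `hδ : kuriharaNumber D.f 9 57007 ψ ≠ 0` DISCHARGED IN THE KERNEL
from the landed two-prime depth-2 record `certK9_X8r0_17200bj1` + the rounding row `certRK9_X8r0_17200bj1` (`KuriharaTwistCertsK9PairN6B.lean`, this gen; implementation 3d `δ̃ ≡ 3 (mod 9)`)
+ the engine's ENCLOSURE `hballL` of `D'·c_∞·re(-486·L(E,1) + Σ_{j≠0} e_9(−jk)·τ(χ_j)·L_j(1))/(9·Ω⁺_f)` for the 9 bins (`A = (a_{109} − 2)(a_{523} − 2) = -486`, `D' = 2`, `c_∞ = 1`,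
margin ≤ 162·10^-22, radius ≤ 183·10^-13; `m₀ = 61308576`) via prover B's `kuriharaNumber_pairLevel_ne_zero_of_ainvs_of_certifiedK_of_LValueBall` (p324167); good reduction at 3,
`109, 523 ∈ 𝒫₂` (`#Ẽ = 90, 549`, `countPointsFast`) and irreducibility (`surj_x8r0_17200bj1_3`) re-derived in the kernel. BINDERS LEFT: the record's minus `hδ` plus `hballL`
(`hK25s` Kim 2025 OPEN; `hW` Wuthrich Prop. 21, `hGZK`, `hmod`, `h3per` published; `r_an = 0`, `htam`, `D`, `ψ`). Per pair; nothing booked; X8 CONSTRUCTION-SHAPED.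
[claim: Kim2025RefinedTNC, status: under-review] [cite: Kim2025RefinedTNC, Thm. 1.1 (ANNOUNCED, OPEN binder)] [cite: Kim2022StructureSelmer, §1.2.2, §1.4.3 (PDF p. 7) and Thm. 1.9 (6)]
[cite: MazurTateTeitelbaum1986Invent, §I.8 (8.6)] [cite: Cremona2006, Table 1 (Cremona label 17200bj1)] -/
theorem bsdp_x8r0kim9L_17200bj1
    (hK25s : Kim2025.thm11_kimShaLength_of_integralPeriod_OPEN) (hW : sha_dvd_analyticSha)
    (hGZK : rank_eq_analyticRank_of_analyticRank_le_one) (hmod : hasEntireLFunction_rat)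
    (h3per : realPeriodRat_eq_unit_mul_plusPeriod_three)
    (W : WeierstrassCurve ℚ) (hWeq : W = ⟨0, 0, 0, -4862875, -4127533750⟩) (hr : W.analyticRank = 0)
    (htam : 2 ≤ padicValNat 3 W.tamagawaProduct + 1)
    {N : ℕ} [NeZero N] (D : ModularParametrizationData W N)
    (ψ : (ℓ : ℕ) → (ZMod ℓ)ˣ →* Multiplicative (ZMod (3 ^ 2)))
    (hψ : ∀ ℓ ∈ (57007 : ℕ).primeFactors, Function.Surjective (ψ ℓ))
    (hballL : ∀ (L : ZMod (3 ^ 2) → ℂ → ℂ), (∀ j, j ≠ 0 → Differentiable ℂ (L j)) →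
      (∀ j, j ≠ 0 → ∀ s : ℂ, 2 < s.re → L j s = twistedLSeries D.f (binChar 57007 ψ j)⁻¹ s) →
      ∀ k < 3 ^ 2, ∃ mid rad : ℝ, rad ≤ ((183 : ℕ) : ℝ) / 10 ^ (13 : ℕ) ∧
        |mid - (([-11664, -11664, -13002, -11646, -11298, -9756, -11298, -11646, -13002].getD k 0 : ℤ) : ℝ)| ≤ ((162 : ℕ) : ℝ) / 10 ^ (22 : ℕ) ∧
        |((2 : ℕ) : ℝ) * (((1 : ℕ) : ℝ) *
          ((((-486 : ℤ) : ℂ) * W.entireLFunction 1 +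
            ∑ j ∈ (Finset.univ : Finset (ZMod (3 ^ 2))).erase 0,
              ZMod.stdAddChar (-(j * (k : ZMod (3 ^ 2)))) *
                (gaussSum (binChar 57007 ψ j) (ZMod.stdAddChar (N := 57007)) * L j 1)).re /
            (((3 ^ 2 : ℕ) : ℝ) * plusPeriod D.f))) - mid| ≤ rad) : BSDp W 3 := by
  subst hWeq
  haveI : Fact (Nat.Prime 3) := ⟨by norm_num⟩
  haveI : Fact (Nat.Prime 109) := ⟨by norm_num⟩
  haveI : Fact (Nat.Prime 523) := ⟨by norm_num⟩
  haveI : NeZero (57007 : ℕ) := ⟨by decide⟩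
  exact bsdp_x8r0kim9_17200bj1 (hK25s := hK25s) (hW := hW) (hGZK := hGZK) (hmod := hmod) (h3per := h3per)
    (W := ⟨0, 0, 0, -4862875, -4127533750⟩) (hWeq := rfl) (hr := hr) (htam := htam) (D := D) (ψ := ψ) (hψ := hψ)
    (hδ := kuriharaNumber_pairLevel_ne_zero_of_ainvs_of_certifiedK_of_LValueBall 0 0 0 (-4862875) (-4127533750)
      (isGloballyMinimal_of_krausCriterion₃_bounded 0 0 0 (-4862875) (-4127533750)
        (by decide +kernel) (by decide +kernel)
        (by set_option synthInstance.maxSize 2000 in decide +kernel))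
      certK9_X8r0_17200bj1 (List.Mem.head _) (by decide) (by decide)
      certRK9_X8r0_17200bj1 (List.Mem.head _) rfl rfl rfl rfl (by decide)
      (by decide) (np := 1) (countPoints_eq_of_fast (by decide +kernel)) (by decide)
      surj_x8r0_17200bj1_3
      109 523 (by norm_num) (by norm_num)
      (by norm_num) (by norm_num) (by decide) (by decide) (n₁ := 90) (countPoints_eq_of_fast (by decide +kernel)) (by decide)
      (by norm_num) (by norm_num) (by decide) (by decide) (n₂ := 549) (countPoints_eq_of_fast (by decide +kernel)) (by decide)
      (A := -486) (by decide) D ψ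
      (hψ 109 (Nat.mem_primeFactors.mpr ⟨by norm_num, by norm_num, by norm_num⟩))
      (hψ 523 (Nat.mem_primeFactors.mpr ⟨by norm_num, by norm_num, by norm_num⟩)) hballL)

/-- **`BSD(E,3)` for `18515u1` at the two-prime level `487·613`, STANDARD CURRENCY** (N6 TAM-DEFECT cell: X8, `r_an = 0`, `N = 18515`, `ord₃ ∏c_ℓ = 1`): exactly my record
`bsdp_x8r0kim9_18515u1` (`RankZeroKimTamDefectRecords.lean`, p308350; `hδ` engines KURX v₃ = 1 / engine K `δ̃ ≡ 6` / engine M MATCH) with its DATUM binder `hδ : kuriharaNumber D.f 9 298531 ψ ≠ 0` DISCHARGED IN THE KERNEL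
from the landed two-prime depth-2 record `certK9_X8r0_18515u1` + the rounding row `certRK9_X8r0_18515u1` (`KuriharaTwistCertsK9PairN6B.lean`, this gen; implementation 3d `δ̃ ≡ 6 (mod 9)`)
+ the engine's ENCLOSURE `hballL` of `D'·c_∞·re(0·L(E,1) + Σ_{j≠0} e_9(−jk)·τ(χ_j)·L_j(1))/(9·Ω⁺_f)` for the 9 bins (`A = (a_{487} − 2)(a_{613} − 2) = 0`, `D' = 2`, `c_∞ = 1`,
margin ≤ 808·10^-23, radius ≤ 846·10^-14; `m₀ = 344046509`) via prover B's `kuriharaNumber_pairLevel_ne_zero_of_ainvs_of_certifiedK_of_LValueBall` (p324167); good reduction at 3,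
`487, 613 ∈ 𝒫₂` (`#Ẽ = 486, 630`, `countPointsFast`) and irreducibility (`surj_x8r0_18515u1_3`) re-derived in the kernel. BINDERS LEFT: the record's minus `hδ` plus `hballL`
(`hK25s` Kim 2025 OPEN; `hW` Wuthrich Prop. 21, `hGZK`, `hmod`, `h3per` published; `r_an = 0`, `htam`, `D`, `ψ`). Per pair; nothing booked; X8 CONSTRUCTION-SHAPED.
[claim: Kim2025RefinedTNC, status: under-review] [cite: Kim2025RefinedTNC, Thm. 1.1 (ANNOUNCED, OPEN binder)] [cite: Kim2022StructureSelmer, §1.2.2, §1.4.3 (PDF p. 7) and Thm. 1.9 (6)]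
[cite: MazurTateTeitelbaum1986Invent, §I.8 (8.6)] [cite: Cremona2006, Table 1 (Cremona label 18515u1)] -/
theorem bsdp_x8r0kim9L_18515u1
    (hK25s : Kim2025.thm11_kimShaLength_of_integralPeriod_OPEN) (hW : sha_dvd_analyticSha)
    (hGZK : rank_eq_analyticRank_of_analyticRank_le_one) (hmod : hasEntireLFunction_rat)
    (h3per : realPeriodRat_eq_unit_mul_plusPeriod_three)
    (W : WeierstrassCurve ℚ) (hWeq : W = ⟨0, 0, 1, -6877, -599225⟩) (hr : W.analyticRank = 0)
    (htam : 2 ≤ padicValNat 3 W.tamagawaProduct + 1)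
    {N : ℕ} [NeZero N] (D : ModularParametrizationData W N)
    (ψ : (ℓ : ℕ) → (ZMod ℓ)ˣ →* Multiplicative (ZMod (3 ^ 2)))
    (hψ : ∀ ℓ ∈ (298531 : ℕ).primeFactors, Function.Surjective (ψ ℓ))
    (hballL : ∀ (L : ZMod (3 ^ 2) → ℂ → ℂ), (∀ j, j ≠ 0 → Differentiable ℂ (L j)) →
      (∀ j, j ≠ 0 → ∀ s : ℂ, 2 < s.re → L j s = twistedLSeries D.f (binChar 298531 ψ j)⁻¹ s) →
      ∀ k < 3 ^ 2, ∃ mid rad : ℝ, rad ≤ ((846 : ℕ) : ℝ) / 10 ^ (14 : ℕ) ∧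
        |mid - (([1092, 1092, -174, 1686, -3234, 1260, -3234, 1686, -174].getD k 0 : ℤ) : ℝ)| ≤ ((808 : ℕ) : ℝ) / 10 ^ (23 : ℕ) ∧
        |((2 : ℕ) : ℝ) * (((1 : ℕ) : ℝ) *
          ((((0 : ℤ) : ℂ) * W.entireLFunction 1 +
            ∑ j ∈ (Finset.univ : Finset (ZMod (3 ^ 2))).erase 0,
              ZMod.stdAddChar (-(j * (k : ZMod (3 ^ 2)))) *
                (gaussSum (binChar 298531 ψ j) (ZMod.stdAddChar (N := 298531)) * L j 1)).re /
            (((3 ^ 2 : ℕ) : ℝ) * plusPeriod D.f))) - mid| ≤ rad) : BSDp W 3 := by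
  subst hWeq
  haveI : Fact (Nat.Prime 3) := ⟨by norm_num⟩
  haveI : Fact (Nat.Prime 487) := ⟨by norm_num⟩
  haveI : Fact (Nat.Prime 613) := ⟨by norm_num⟩
  haveI : NeZero (298531 : ℕ) := ⟨by decide⟩
  exact bsdp_x8r0kim9_18515u1 (hK25s := hK25s) (hW := hW) (hGZK := hGZK) (hmod := hmod) (h3per := h3per)
    (W := ⟨0, 0, 1, -6877, -599225⟩) (hWeq := rfl) (hr := hr) (htam := htam) (D := D) (ψ := ψ) (hψ := hψ)
    (hδ := kuriharaNumber_pairLevel_ne_zero_of_ainvs_of_certifiedK_of_LValueBall 0 0 1 (-6877) (-599225)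
      (isGloballyMinimal_of_krausCriterion_bounded 0 0 1 (-6877) (-599225)
        (by decide +kernel) (by decide +kernel) (by decide +kernel))
      certK9_X8r0_18515u1 (List.Mem.head _) (by decide) (by decide)
      certRK9_X8r0_18515u1 (List.Mem.head _) rfl rfl rfl rfl (by decide)
      (by decide) (np := 1) (countPoints_eq_of_fast (by decide +kernel)) (by decide)
      surj_x8r0_18515u1_3
      487 613 (by norm_num) (by norm_num)
      (by norm_num) (by norm_num) (by decide) (by decide) (n₁ := 486) (countPoints_eq_of_fast (by decide +kernel)) (by decide)
      (by norm_num) (by norm_num) (by decide) (by decide) (n₂ := 630) (countPoints_eq_of_fast (by decide +kernel)) (by decide)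
      (A := 0) (by decide) D ψ
      (hψ 487 (Nat.mem_primeFactors.mpr ⟨by norm_num, by norm_num, by norm_num⟩))
      (hψ 613 (Nat.mem_primeFactors.mpr ⟨by norm_num, by norm_num, by norm_num⟩)) hballL)

end Summit.BirchSwinnertonDyer.Rank1Residual.Supersingular

end
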